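import Literature.Computability.Complexity.LabelCover
import Literature.Computability.Complexity.GapCSPQueried
import Literature.Computability.Complexity.CSPToCMMSAMachine
import HarnessLib

/-!
# Label cover instances as arity-`2` MaxCSP instances

Topic `Computability/Complexity`. The (trivial) embedding of regular projection `2CSP_W`
instances (`LabelCover.lean`: Arora–Barak 2009, Def. 22.1 and §22.3) into the MaxCSP instances
of `GapCSP.lean` (Hirahara 2022, proof of Thm. 5.2: constraints `Cⱼ` with their lists of
accepting local assignments `Cⱼ⁻¹(1)`): the projection constraint `(i, j, h)` becomes the
constraint on `vars = [i, j]` with `accepting = [[u, h u] | u < W]`. This is the front end by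
which the NP-hardness of gap label cover (PCP theorem with Raz's parallel repetition theorem,
Arora–Barak 2009, Thm. 22.15) feeds the Dinur–Safra reduction to CMMSA (`CSPToCMMSA.lean`) at a
CONSTANT gap (`CMMSAFromLabelCover.lean`).

## Main results

* `LabelCoverConstraint.toCSP`, `LabelCoverInstance.toCSP` — the embedding;
* `LabelCoverConstraint.isSatisfiedBy_toCSP` — `C.toCSP` is satisfied by `a` iff `C` is
  (`h (a i) = a j`), hence `satCount_toCSP`, `isSatisfiable_toCSP_iff`;
* `LabelCoverInstance.WellFormed.toCSP`, `hasArity_toCSP` — well-formed instances over `[W]` go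
  to well-formed MaxCSP instances of arity exactly `2` over the alphabet `[W]`;
* `LabelCoverInstance.allVarsQueried_toCSP` — for well-formed REGULAR instances every variable
  occurs in a constraint (the common degree is positive since `m ≥ 1`), so `n ≤ Σⱼ |dom Cⱼ| = 2m`
  (`numVars_le_totalArity_toCSP`);
* `LabelCoverToCSPMachine.codeFP_toCSP` — the embedding is computed on codes
  (`LabelCoverInstance.encoding` → `CSPInstance.encoding`) by a polynomial-time string function,
  assembled from the typed `CodeFP` combinators (`CodeFP.lean`) in the style of
  `CSPToCMMSAMachine.lean`: on tuples, `lcT (n, W, [(i, j, h)]) = (n, W, [([i, j], [[u, h u] | u < |h|])])`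
  is a `map` of a `brange`/`rawGetD` program.

## References

* S. Arora, B. Barak, *Computational Complexity: A Modern Approach*, CUP 2009: Def. 11.11
  (`qCSP_W`), Def. 22.1, §22.3 (projection property, regular instances), Thm. 22.15, §1.3
  (robustness of polynomial time) [AroraBarak2009].
* S. Hirahara, *NP-hardness of learning programs and partial MCSP*, FOCS 2022; ECCC TR22-119,
  proof of Thm. 5.2 (p. 16: MaxCSP instances with accepting lists) [Hirahara2022PartialMCSP].
-/

namespace Literature.Computability.Complexity

/-! ### The embedding of a constraint -/

namespace LabelCoverConstraint

/-- The accepting local assignments `[[u, h u] | u < |proj|]` of a projection constraint.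
[cite: AroraBarak2009, §22.3 (projection property: satisfied by (u, v) iff h(u) = v)] -/
def accepting (C : LabelCoverConstraint) : List (List ℕ) :=
  (List.range C.proj.length).map fun u => [u, C.projAt u]

/-- **The projection constraint `(i, j, h)` as a MaxCSP constraint**: variables `[i, j]`,
accepting views `[[u, h u] | u < W]`. [cite: AroraBarak2009, Def. 11.11 and §22.3 (p. 470)] -/
def toCSP (C : LabelCoverConstraint) : CSPConstraint :=
  ⟨[C.fst, C.snd], C.accepting⟩

/-- The variables of `C.toCSP` (definitional). [folklore] -/
@[simp] theorem toCSP_vars (C : LabelCoverConstraint) : C.toCSP.vars = [C.fst, C.snd] := rfl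

/-- The accepting views of `C.toCSP` (definitional). [folklore] -/
@[simp] theorem toCSP_accepting (C : LabelCoverConstraint) : C.toCSP.accepting = C.accepting := rfl

/-- Membership in the accepting list: `[u', v] ∈ accepting ↔ u' < |proj| ∧ h u' = v`. [cite: AroraBarak2009, §22.3 (p. 470)] -/
theorem pair_mem_accepting_iff (C : LabelCoverConstraint) (u v : ℕ) :
    [u, v] ∈ C.accepting ↔ u < C.proj.length ∧ C.projAt u = v := by
  unfold accepting
  rw [List.mem_map]
  constructor
  · rintro ⟨u', hu', h⟩
    rw [List.mem_range] at hu'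
    simp only [List.cons.injEq, and_true] at h
    obtain ⟨rfl, rfl⟩ := h
    exact ⟨hu', rfl⟩
  · rintro ⟨hu, rfl⟩
    exact ⟨u, List.mem_range.2 hu, rfl⟩

/-- Every accepting view is a pair `[u, h u]` with `u < |proj|`. [cite: AroraBarak2009, §22.3 (p. 470)] -/
theorem mem_accepting_iff (C : LabelCoverConstraint) (r : List ℕ) :
    r ∈ C.accepting ↔ ∃ u, u < C.proj.length ∧ r = [u, C.projAt u] := by
  unfold accepting
  rw [List.mem_map]
  constructor
  · rintro ⟨u, hu, rfl⟩
    exact ⟨u, List.mem_range.1 hu, rfl⟩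
  · rintro ⟨u, hu, rfl⟩
    exact ⟨u, List.mem_range.2 hu, rfl⟩

/-- The accepting list has no repetition (its entries have distinct first letters). [folklore] -/
theorem nodup_accepting (C : LabelCoverConstraint) : C.accepting.Nodup := by
  unfold accepting
  refine (List.nodup_range).map ?_
  intro u u' h
  simp only [List.cons.injEq] at h
  exact h.1

/-- The accepting list has `|proj|` entries. [folklore] -/
@[simp] theorem length_accepting (C : LabelCoverConstraint) : C.accepting.length = C.proj.length := by
  simp [accepting]

/-- **Semantics is preserved**: `C.toCSP` is satisfied by `a` iff `h (a i) = a j`.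
[cite: AroraBarak2009, Def. 11.11 and §22.3 (p. 470)] -/
theorem isSatisfiedBy_toCSP (C : LabelCoverConstraint) (a : ℕ → ℕ) :
    C.toCSP.IsSatisfiedBy a = C.Sat a := by
  rw [Bool.eq_iff_iff, CSPConstraint.isSatisfiedBy_eq_true_iff]
  simp only [toCSP_vars, toCSP_accepting, List.map_cons, List.map_nil]
  rw [pair_mem_accepting_iff]
  constructor
  · rintro ⟨hlt, heq⟩
    exact sat_of_projAt_eq hlt heq
  · exact projAt_eq_of_sat

/-- Well-formed projection constraints over `n` variables and `[W]` go to well-formed MaxCSP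
constraints over `n` variables and the alphabet `[W]`. [cite: AroraBarak2009, Def. 22.1 and §22.3 (p. 470)] -/
theorem WellFormed.toCSP {n W : ℕ} {C : LabelCoverConstraint} (h : C.WellFormed n W) :
    C.toCSP.WellFormed n W := by
  have h' := h
  obtain ⟨hi, hj, hij, hlen, -⟩ := h'
  refine ⟨?_, ?_, nodup_accepting C, ?_⟩
  · intro x hx
    simp only [toCSP_vars, List.mem_cons, List.not_mem_nil, or_false] at hx
    rcases hx with rfl | rfl
    · exact hi
    · exact hj
  · simp [hij]
  · intro r hr
    rw [toCSP_accepting, mem_accepting_iff] at hr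
    obtain ⟨u, hu, rfl⟩ := hr
    refine ⟨rfl, ?_⟩
    intro v hv
    simp only [List.mem_cons, List.not_mem_nil, or_false] at hv
    rw [hlen] at hu
    rcases hv with rfl | rfl
    · exact hu
    · exact h.projAt_lt hu

/-- `C.toCSP` depends on exactly `2` variables. [cite: AroraBarak2009, Def. 11.11 (2CSP)] -/
theorem length_toCSP_vars (C : LabelCoverConstraint) : C.toCSP.vars.length = 2 := rfl

end LabelCoverConstraint

/-! ### The embedding of an instance -/

namespace LabelCoverInstance

/-- **A label cover instance as a MaxCSP instance** of arity `2` over the same alphabet `[W]`: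
same variables, the constraints `φᵣ.toCSP`. [cite: AroraBarak2009, Def. 11.11, Def. 22.1 and §22.3 (p. 470)] -/
def toCSP (φ : LabelCoverInstance) : CSPInstance :=
  ⟨φ.numVars, φ.alphabetSize, φ.constraints.map LabelCoverConstraint.toCSP⟩

/-- Same number of variables (definitional). [folklore] -/
@[simp] theorem toCSP_numVars (φ : LabelCoverInstance) : φ.toCSP.numVars = φ.numVars := rfl

/-- Same alphabet (definitional). [folklore] -/
@[simp] theorem toCSP_alphabetSize (φ : LabelCoverInstance) : φ.toCSP.alphabetSize = φ.alphabetSize := rfl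

/-- The constraints of `φ.toCSP` (definitional). [folklore] -/
@[simp] theorem toCSP_constraints (φ : LabelCoverInstance) :
    φ.toCSP.constraints = φ.constraints.map LabelCoverConstraint.toCSP := rfl

/-- Same number of constraints. [folklore] -/
@[simp] theorem numConstraints_toCSP (φ : LabelCoverInstance) :
    φ.toCSP.numConstraints = φ.numConstraints := by
  simp [CSPInstance.numConstraints, numConstraints]

/-- **Same number of satisfied constraints** under every assignment. [cite: AroraBarak2009, Def. 11.11] -/
@[simp] theorem satCount_toCSP (φ : LabelCoverInstance) (a : ℕ → ℕ) :
    φ.toCSP.satCount a = φ.satCount a := by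
  simp only [CSPInstance.satCount, satCount, toCSP_constraints, List.countP_map]
  congr 1
  funext C
  exact LabelCoverConstraint.isSatisfiedBy_toCSP C a

/-- Satisfiability is preserved and reflected. [cite: AroraBarak2009, Def. 11.11] -/
theorem isSatisfiable_toCSP_iff (φ : LabelCoverInstance) :
    φ.toCSP.IsSatisfiable ↔ φ.IsSatisfiable := by
  simp only [CSPInstance.IsSatisfiable, IsSatisfiable, toCSP_constraints, List.forall_mem_map,
    LabelCoverConstraint.isSatisfiedBy_toCSP]

/-- Well-formed label cover instances go to well-formed MaxCSP instances. [cite: AroraBarak2009, Def. 22.1 and §22.3 (p. 470)] -/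
theorem WellFormed.toCSP {φ : LabelCoverInstance} (h : φ.WellFormed) : φ.toCSP.WellFormed := by
  obtain ⟨hm, hC⟩ := h
  refine ⟨by simpa using hm, ?_⟩
  intro C hC'
  rw [toCSP_constraints, List.mem_map] at hC'
  obtain ⟨C₀, hC₀, rfl⟩ := hC'
  exact (hC C₀ hC₀).toCSP

/-- `φ.toCSP` has arity exactly `2`. [cite: AroraBarak2009, Def. 11.11 (2CSP)] -/
theorem hasArity_toCSP (φ : LabelCoverInstance) : φ.toCSP.HasArity 2 := by
  intro C hC
  rw [toCSP_constraints, List.mem_map] at hC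
  obtain ⟨C₀, -, rfl⟩ := hC
  rfl

/-- The total arity of `φ.toCSP` is `2m`. [folklore] -/
theorem totalArity_toCSP (φ : LabelCoverInstance) : φ.toCSP.totalArity = φ.numConstraints * 2 := by
  rw [CSPInstance.totalArity_eq_of_hasArity φ.hasArity_toCSP, numConstraints_toCSP]

/-- In a well-formed regular instance every variable occurs in some constraint: the common
degree `d` is the degree of the first variable of the first constraint, which is positive.
[cite: AroraBarak2009, §22.3 (regular instances, p. 470)] -/
theorem exists_mem_of_regular {φ : LabelCoverInstance} (hwf : φ.WellFormed) (hreg : φ.IsRegular)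
    {i : ℕ} (hi : i < φ.numVars) : ∃ C ∈ φ.constraints, C.fst = i ∨ C.snd = i := by
  obtain ⟨d, hd⟩ := hreg
  obtain ⟨hm, hC⟩ := hwf
  obtain ⟨C₀, hC₀⟩ := List.exists_mem_of_length_pos hm
  -- the degree of `C₀.fst` is positive, hence so is `d`
  have hdeg₀ : 0 < φ.degree C₀.fst := by
    unfold degree
    have : 0 < φ.constraints.countP fun C => C.fst = C₀.fst :=
      List.countP_pos_iff.2 ⟨C₀, hC₀, by simp⟩
    omega
  have hdpos : 0 < d := by rw [← hd _ (hC C₀ hC₀).1]; exact hdeg₀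
  have hdi : 0 < φ.degree i := by rw [hd i hi]; exact hdpos
  unfold degree at hdi
  by_cases h1 : 0 < φ.constraints.countP fun C => C.fst = i
  · obtain ⟨C, hCmem, hCi⟩ := List.countP_pos_iff.1 h1
    exact ⟨C, hCmem, Or.inl (by simpa using hCi)⟩
  · have h2 : 0 < φ.constraints.countP fun C => C.snd = i := by omega
    obtain ⟨C, hCmem, hCi⟩ := List.countP_pos_iff.1 h2
    exact ⟨C, hCmem, Or.inr (by simpa using hCi)⟩

/-- **Every variable of `φ.toCSP` is queried** when `φ` is well formed and regular.
[cite: AroraBarak2009, §22.3 (regular instances, p. 470) and Remark 11.6 (2)] -/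
theorem allVarsQueried_toCSP {φ : LabelCoverInstance} (hwf : φ.WellFormed) (hreg : φ.IsRegular) :
    φ.toCSP.AllVarsQueried := by
  intro x hx
  obtain ⟨C, hC, hCx⟩ := exists_mem_of_regular hwf hreg (by simpa using hx)
  refine ⟨C.toCSP, ?_, ?_⟩
  · rw [toCSP_constraints]
    exact List.mem_map_of_mem hC
  · rcases hCx with rfl | rfl <;> simp

/-- Hence `n ≤ Σⱼ |dom Cⱼ| = 2m` for well-formed regular instances. [cite: AroraBarak2009, Remark 11.6 (2)] -/
theorem numVars_le_totalArity_toCSP {φ : LabelCoverInstance} (hwf : φ.WellFormed) (hreg : φ.IsRegular) :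
    φ.numVars ≤ φ.toCSP.totalArity :=
  CSPInstance.numVars_le_sum_length_of_allVarsQueried (allVarsQueried_toCSP hwf hreg)

/-- The tuple of `φ.toCSP` in terms of the tuple of `φ`. [folklore] -/
theorem toTuple_toCSP (φ : LabelCoverInstance) :
    φ.toCSP.toTuple = (φ.numVars, φ.alphabetSize,
      φ.constraints.map fun C => ([C.fst, C.snd], C.accepting)) := by
  simp [CSPInstance.toTuple, toCSP, LabelCoverConstraint.toCSP]

end LabelCoverInstance

/-! ### The embedding is polynomial time on codes -/

section Machine

open _root_.Computability CodeFP
open CSPToCMMSAMachine (Constr TI cE tiE tiE_eq)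

namespace LabelCoverToCSPMachine

/-! ### The map on tuples -/

/-- Projection-constraint tuples `(i, j, h)` (as inside `LabelCoverInstance.toTuple`). [folklore] -/
abbrev LCon : Type := ℕ × ℕ × List ℕ

/-- Input tuples `(n, W, [(iᵣ, jᵣ, hᵣ)]ᵣ)` (`LabelCoverInstance.toTuple`). [folklore] -/
abbrev LTI : Type := ℕ × ℕ × List LCon

/-- The accepting list `[[u, h u] | u < |h|]` read off the value list of `h`. [cite: AroraBarak2009, §22.3 (projection property, p. 470)] -/
def accT (proj : List ℕ) : List (List ℕ) :=
  (List.range proj.length).map fun u => [u, proj.getD u 0]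

/-- `accT` is the accepting list of `LabelCoverToCSP.lean` (definitional). [folklore] -/
theorem accT_eq (C : LabelCoverConstraint) : accT C.proj = C.accepting := rfl

/-- One constraint tuple. [cite: AroraBarak2009, Def. 11.11 and §22.3 (p. 470)] -/
def conT (c : LCon) : Constr := ([c.1, c.2.1], accT c.2.2)

/-- **The embedding on tuples.** [cite: AroraBarak2009, Def. 11.11 and §22.3 (p. 470)] -/
def lcT (t : LTI) : TI := (t.1, t.2.1, t.2.2.map conT)

/-- `lcT` computes `toCSP` on tuples. [folklore] -/
theorem lcT_toTuple (φ : LabelCoverInstance) : lcT φ.toTuple = φ.toCSP.toTuple := by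
  rw [LabelCoverInstance.toTuple_toCSP]
  simp only [lcT, LabelCoverInstance.toTuple, List.map_map, Prod.mk.injEq, true_and]
  refine List.map_congr_left fun C _ => ?_
  simp [conT, accT_eq]

/-! ### Codes -/

/-- The code of a projection-constraint tuple (as inside `LabelCoverInstance.encoding`). [folklore] -/
def lcE : LCon → List Bool := pairE natE (pairE natE (listE natE))

/-- The code of input tuples (`LabelCoverInstance.tupleEncoding`, `ltiE_eq`). [folklore] -/
def ltiE : LTI → List Bool := pairE natE (pairE natE (listE lcE))

/-- `LabelCoverInstance.tupleEncoding` codes by `ltiE`. [folklore] -/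
theorem ltiE_eq : (LabelCoverInstance.tupleEncoding.encode : LTI → List Bool) = ltiE := by
  simp only [LabelCoverInstance.tupleEncoding, pairE_eq, listE_eq, natE_eq]; rfl

/-! ### The embedding is polynomial time on codes -/

/-- The accepting list is computed in polynomial time (a `map` over `brange |h|` of the indexing
program `rawGetD`). [folklore] -/
theorem codeFP_accT : CodeFP (rawE natE) (rawE (listE natE)) accT := by
  -- the item `[u, h u]` from `(h, u)`
  have hget : CodeFP (pairE (rawE natE) natE) natE (fun p => p.1.getD p.2 0) := rawGetD natE natE_zero
  have hitem : CodeFP (pairE (rawE natE) natE) (listE natE) (fun p => [p.2, p.1.getD p.2 0]) :=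
    (listOfRaw natE).comp ((rawCons natE).comp ((snd _ _).pair ((rawSingleton natE).comp hget)))
  -- the index list `range |h|` next to `h`
  have hrange : CodeFP (rawE natE) (rawE natE) (fun l => List.range (min l.length l.length)) :=
    (brange natE).comp ((recode fun _ => rfl).pair (natLength natE))
  refine ((map hitem).comp ((recode fun _ => rfl).pair hrange)).congr fun l => ?_
  simp [accT]

/-- One constraint tuple is computed in polynomial time. [folklore] -/
theorem codeFP_conT : CodeFP lcE cE conT := by
  have hvars : CodeFP lcE (listE natE) (fun c => [c.1, c.2.1]) :=
    (listOfRaw natE).comp ((rawCons natE).comp ((fst _ _).pair ((rawSingleton natE).comp (snd _ _).fst')))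
  have hacc : CodeFP lcE (listE (listE natE)) (fun c => accT c.2.2) :=
    (listOfRaw _).comp (codeFP_accT.comp ((rawOfList natE).comp (snd _ _).snd'))
  exact (hvars.pair hacc).congr fun _ => rfl

/-- **The embedding on tuples is polynomial time on codes.** [cite: AroraBarak2009, §1.3 and §22.3] -/
theorem codeFP_lcT : CodeFP ltiE tiE lcT := by
  have hcs : CodeFP ltiE (listE cE) (fun t => t.2.2.map conT) :=
    (listOfRaw cE).comp ((map₀ codeFP_conT).comp ((rawOfList lcE).comp (snd _ _).snd'))
  exact ((fst _ _).pair ((snd _ _).fst'.pair hcs)).congr fun _ => rfl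

/-- **`LabelCoverInstance.toCSP` is computed on codes by a polynomial-time string function**,
between the tree's encodings of label cover and MaxCSP instances. [cite: AroraBarak2009, §1.3 and §22.3] -/
theorem codeFP_toCSP :
    CodeFP LabelCoverInstance.encoding.encode CSPInstance.encoding.encode LabelCoverInstance.toCSP := by
  obtain ⟨f, hf, hfd⟩ := codeFP_lcT
  refine ⟨f, hf, fun φ => ?_⟩
  rw [LabelCoverInstance.encoding_encode, CSPInstance.encoding_encode, ltiE_eq, tiE_eq, hfd, lcT_toTuple]

end LabelCoverToCSPMachine

end Machine

end Literature.Computability.Complexity
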